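import Literature.NumberTheory.Sieve.HeathBrownCubicTypeIProofs
import Literature.NumberTheory.Sieve.HeathBrownMorozClassMoebius
import HarnessLib

/-!
# The singular series of the class Type-I main term (Heath-Brown–Moroz 2004, (2.29)/(3.1))

Pure-proof file in the residue-class ("coset") port of D. R. Heath-Brown, *Primes represented by
`x³ + 2y³`*, Acta Math. 186 (2001), §5, to the sequence of D. R. Heath-Brown and B. Z. Moroz,
*On the representation of primes by cubic polynomials in two variables*, Proc. LMS 88 (2004), §2
(the class `x ≡ a, y ≡ b (mod d)` of the box, `CubicSieve.classPairs` / `classCountA`).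
After the Möbius inversion of the coprimality condition (`classCountA_eq_sum_moebius`, the class
(5.3)) only the `g` coprime to `d` survive (`class_term_eq_zero_of_not_coprime`), and the class
Type-I main term is the restricted singular series `∑_{(g,d)=1} μ(g)(N(R),g)/g²`.  This file proves
the class (5.4): for `m ≥ 1` coprime to `d ≥ 1`,
`∑_{(g,d)=1} μ(g)(m,g)/g² = (6/π²)·∏_{p∣d}(1 − p⁻²)⁻¹·∏_{p∣m}(1 + 1/p)⁻¹`
(Euler product of the multiplicative summand, whose factor at `p` is `1` if `p ∣ d`, `1 − 1/p` if
`p ∣ m`, `1 − 1/p²` otherwise) — the factor `ζ(2)/ζ_d(2) = CubicPrimes.zetaTwoCorrection d` of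
[HBM, (2.29)/(3.1)] times Heath-Brown's `(6/π²)ρ₂(R)/N(R)`; bounds its tail by `4τ(m)/Δ`
(`sum_Ioc_gcd_div_sq_le`); and performs the split of the class error at `Δ` (p. 31 of the 2001
paper) for one `R ∈ 𝒯r` — `abs_classCountA_sub_mainTerm_le`, the class analogue of
`abs_countA_sub_mainTerm_le` (`HeathBrownCubicTypeIProofs`).

## Content (namespace `Literature.NumberTheory.Sieve.CubicSieve`)
* `coprimeTerm_mul`, `norm_coprimeTerm_le`, `norm_coprimeTerm_le_gcd_div_sq`,
  `summable_norm_coprimeTerm`, `tsum_coprimeTerm_prime_pow`, `filter_dvd_primesBelow_eq`;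
* **`tsum_moebius_gcd_div_sq_coprime`** — the restricted singular series;
* `abs_tsum_coprimeTerm_tail_le`, `tsum_coprimeTerm_eq_sum_add_tail` — tail and split at `Δ`;
* **`classMainTerm_eq_tsum`** — `(6/π²)(ζ(2)/ζ_d(2))ρ₂(R)/N(R) = N(R)⁻¹∑_{(g,d)=1} μ(g)(N(R),g)/g²`
  for `R ∈ 𝒯r` with `(d, N(R)) = 1`;
* **`abs_classCountA_sub_mainTerm_le`** — the split at `Δ` of
  `|#𝒜_R(class) − [(d,N(R))=1](6η²X²/π²)(ζ(2)/ζ_d(2))d⁻²ρ₂(R)/N(R)|` (head, middle, series tail).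

## Faithfulness
The 2004 paper states the main term as `η²X²Γ(q)/ζ_d(2)` ((2.29)) over rational moduli `q`; as
everywhere in this port the level is carried over ideals `R` of `ℚ(2^{1/3})` as in the 2001 paper,
and `Γ`'s factor `0` at `p ∣ d` is the indicator `[(d, N(R)) = 1]` (`classCountA_eq_zero_of_not_coprime`).
Constants are absolute. [cite: HeathBrownMoroz2004, Lemma 2.4 (2.29)] [cite: HeathBrownActa2001, §5 (5.4)]
Search: `lean search 'zetaTwoCorrection|tsum_moebius_gcd_div_sq'` — only the unrestricted series and
the definition `CubicPrimes.zetaTwoCorrection` exist.  Mathlib: `EulerProduct.eulerProduct`.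
-/

noncomputable section

open NumberField Finset Filter

open scoped Topology ArithmeticFunction.sigma

namespace Literature.NumberTheory.Sieve.CubicSieve

open LFunctions.CubeRootTwoField CubicPrimes

/-! ### The summand `[(g,d)=1] μ(g)(m,g)/g²` -/

/-- Multiplicativity of `g ↦ [(g,d)=1] μ(g)(m,g)/g²` (both `μ(g)(m,g)/g²` and the indicator of
`(g, d) = 1` are multiplicative). [cite: HeathBrownActa2001, §5 (5.4)] -/
theorem coprimeTerm_mul (m d : ℕ) {u v : ℕ} (huv : Nat.Coprime u v) :
    (if Nat.Coprime (u * v) d then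
        (ArithmeticFunction.moebius (u * v) : ℝ) * Nat.gcd m (u * v) / ((u * v : ℕ) : ℝ) ^ 2
      else 0) =
      (if Nat.Coprime u d then (ArithmeticFunction.moebius u : ℝ) * Nat.gcd m u / (u : ℝ) ^ 2
        else 0) *
        (if Nat.Coprime v d then (ArithmeticFunction.moebius v : ℝ) * Nat.gcd m v / (v : ℝ) ^ 2
          else 0) := by
  by_cases hu : Nat.Coprime u d
  · by_cases hv : Nat.Coprime v d
    · rw [if_pos (Nat.Coprime.mul_left hu hv), if_pos hu, if_pos hv]
      exact moebius_gcd_div_sq_mul huv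
    · rw [if_neg hv, mul_zero, if_neg fun h => hv (Nat.Coprime.coprime_mul_left h)]
  · rw [if_neg hu, zero_mul, if_neg fun h => hu (Nat.Coprime.coprime_mul_right h)]

/-- The majorant `|[(g,d)=1] μ(g)(m,g)/g²| ≤ (m,g)/g²` (`≤ m/g²`). [cite: HeathBrownActa2001, §5 (5.5)] -/
theorem norm_coprimeTerm_le_gcd_div_sq (m d g : ℕ) :
    ‖(if Nat.Coprime g d then (ArithmeticFunction.moebius g : ℝ) * Nat.gcd m g / (g : ℝ) ^ 2
        else 0)‖ ≤ (Nat.gcd m g : ℝ) / (g : ℝ) ^ 2 := by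
  split_ifs
  · rw [Real.norm_eq_abs, abs_div, abs_mul, Nat.abs_cast,
      abs_of_nonneg (by positivity : (0 : ℝ) ≤ (g : ℝ) ^ 2)]
    refine div_le_div_of_nonneg_right ?_ (by positivity)
    have h1 : |(ArithmeticFunction.moebius g : ℝ)| ≤ 1 := by
      exact_mod_cast ArithmeticFunction.abs_moebius_le_one
    exact (mul_le_mul_of_nonneg_right h1 (Nat.cast_nonneg _)).trans_eq (one_mul _)
  · rw [norm_zero]; positivity

/-- The restricted singular series is absolutely summable. [cite: HeathBrownActa2001, §5 (5.4)] -/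
theorem summable_norm_coprimeTerm {m : ℕ} (hm : 0 < m) (d : ℕ) :
    Summable fun g : ℕ =>
      ‖(if Nat.Coprime g d then (ArithmeticFunction.moebius g : ℝ) * Nat.gcd m g / (g : ℝ) ^ 2
          else 0)‖ :=
  Summable.of_nonneg_of_le (fun _ => norm_nonneg _)
    (fun g => (norm_coprimeTerm_le_gcd_div_sq m d g).trans (by
      rw [div_eq_mul_inv]
      exact mul_le_mul_of_nonneg_right (by exact_mod_cast Nat.gcd_le_left g hm) (by positivity)))
    ((Real.summable_nat_pow_inv.mpr one_lt_two).mul_left (m : ℝ))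

/-- The local factor at a prime `p`: `∑_e [(p^e,d)=1] μ(p^e)(m,p^e)/p^{2e}` is `1` if `p ∣ d` and
`1 − (m,p)/p²` otherwise. [cite: HeathBrownActa2001, §5 (5.4)] -/
theorem tsum_coprimeTerm_prime_pow (m d : ℕ) {p : ℕ} (hp : p.Prime) :
    ∑' e : ℕ, (if Nat.Coprime (p ^ e) d then
        (ArithmeticFunction.moebius (p ^ e) : ℝ) * Nat.gcd m (p ^ e) / ((p ^ e : ℕ) : ℝ) ^ 2
      else 0) =
      if p ∣ d then 1 else 1 - Nat.gcd m p / (p : ℝ) ^ 2 := by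
  rw [tsum_eq_sum (s := {0, 1})]
  · rw [Finset.sum_pair zero_ne_one, pow_zero, pow_one, if_pos (Nat.coprime_one_left d),
      ArithmeticFunction.moebius_apply_one, ArithmeticFunction.moebius_apply_prime hp,
      Nat.gcd_one_right]
    have h1 : ((1 : ℤ) : ℝ) * ((1 : ℕ) : ℝ) / ((1 : ℕ) : ℝ) ^ 2 = 1 := by push_cast; norm_num
    rw [h1]
    by_cases hpd : p ∣ d
    · rw [if_pos hpd, if_neg fun h => hp.ne_one (Nat.Coprime.eq_one_of_dvd h hpd), add_zero]
    · rw [if_neg hpd, if_pos ((Nat.Prime.coprime_iff_not_dvd hp).mpr hpd)]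
      push_cast
      ring
  · intro e he
    simp only [Finset.mem_insert, Finset.mem_singleton, not_or] at he
    rw [ArithmeticFunction.moebius_apply_prime_pow hp he.1, if_neg he.2]
    simp

/-- For `n > k ≥ 1`, `{p < n prime : p ∣ k} = primeFactors k`. [cite: HeathBrownActa2001, §5 (5.4)] -/
theorem filter_dvd_primesBelow_eq {k : ℕ} (hk : 0 < k) {n : ℕ} (hn : k < n) :
    (Nat.primesBelow n).filter (· ∣ k) = k.primeFactors := by
  ext p
  simp only [Finset.mem_filter, Nat.mem_primesBelow, Nat.mem_primeFactors]
  exact ⟨fun ⟨⟨_, hp⟩, hpk⟩ => ⟨hp, hpk, hk.ne'⟩,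
    fun ⟨hp, hpk, _⟩ => ⟨⟨(Nat.le_of_dvd hk hpk).trans_lt hn, hp⟩, hpk⟩⟩

/-! ### The restricted singular series -/

/-- **The singular series of the class main term**: for `m ≥ 1` coprime to `d ≥ 1`,
`∑_{g ≥ 1, (g,d)=1} μ(g)(m,g)/g² = (6/π²)·(ζ(2)/ζ_d(2))·∏_{p∣m}(1 + 1/p)⁻¹`, where
`ζ(2)/ζ_d(2) = ∏_{p∣d}(1 − p⁻²)⁻¹ = CubicPrimes.zetaTwoCorrection d` — the Euler product of the
multiplicative summand (`coprimeTerm_mul`, local factors `tsum_coprimeTerm_prime_pow`) against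
`∏_p(1 − p⁻²) = 6/π²`; the primes `p ∣ m` do not divide `d`.  This is the factor `1/ζ_d(2)` of
[HBM, (2.29)] combined with Heath-Brown's (5.4).
[cite: HeathBrownMoroz2004, Lemma 2.4 (2.29)] [cite: HeathBrownActa2001, §5 (5.4)] -/
theorem tsum_moebius_gcd_div_sq_coprime {m d : ℕ} (hm : 0 < m) (hd : 0 < d)
    (hmd : Nat.Coprime m d) :
    ∑' g : ℕ, (if Nat.Coprime g d then
        (ArithmeticFunction.moebius g : ℝ) * Nat.gcd m g / (g : ℝ) ^ 2 else 0) =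
      6 / Real.pi ^ 2 * zetaTwoCorrection d * ∏ p ∈ m.primeFactors, (1 + (p : ℝ)⁻¹)⁻¹ := by
  set f : ℕ → ℝ := fun g => if Nat.Coprime g d then
    (ArithmeticFunction.moebius g : ℝ) * Nat.gcd m g / (g : ℝ) ^ 2 else 0 with hf
  have hf₀ : f 0 = 0 := by
    simp only [hf]
    split_ifs <;> simp
  have hf₁ : f 1 = 1 := by
    simp only [hf, if_pos (Nat.coprime_one_left d)]
    simp
  have hmul : ∀ {a b : ℕ}, Nat.Coprime a b → f (a * b) = f a * f b := fun hab => by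
    simp only [hf]
    exact coprimeTerm_mul m d hab
  have hE := EulerProduct.eulerProduct hf₁ hmul (summable_norm_coprimeTerm hm d) hf₀
  -- the local factors
  have hloc : ∀ n : ℕ, ∏ p ∈ Nat.primesBelow n, ∑' e : ℕ, f (p ^ e) =
      (∏ p ∈ Nat.primesBelow n, (1 - ((p : ℝ) ^ 2)⁻¹)) *
        ((∏ p ∈ (Nat.primesBelow n).filter (· ∣ d), (1 - ((p : ℝ) ^ 2)⁻¹)⁻¹) *
          ∏ p ∈ (Nat.primesBelow n).filter (· ∣ m), (1 + (p : ℝ)⁻¹)⁻¹) := by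
    intro n
    rw [Finset.prod_filter, Finset.prod_filter, ← Finset.prod_mul_distrib,
      ← Finset.prod_mul_distrib]
    refine Finset.prod_congr rfl fun p hp => ?_
    have hpp : p.Prime := Nat.prime_of_mem_primesBelow hp
    have hp0 : (p : ℝ) ≠ 0 := by exact_mod_cast hpp.ne_zero
    have hp1 : (p : ℝ) + 1 ≠ 0 := by positivity
    have hp2 : (2 : ℝ) ≤ p := by exact_mod_cast hpp.two_le
    have hpsq : 1 - ((p : ℝ) ^ 2)⁻¹ ≠ 0 := by
      have h4 : (4 : ℝ) ≤ (p : ℝ) ^ 2 := by nlinarith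
      have : ((p : ℝ) ^ 2)⁻¹ ≤ 4⁻¹ := inv_anti₀ (by norm_num) h4
      linarith [show (4 : ℝ)⁻¹ < 1 by norm_num]
    simp only [hf]
    rw [tsum_coprimeTerm_prime_pow m d hpp]
    by_cases hpd : p ∣ d
    · have hpm : ¬ p ∣ m := fun h => hpp.ne_one (Nat.eq_one_of_dvd_coprimes hmd h hpd)
      rw [if_pos hpd, if_pos hpd, if_neg hpm, mul_one, mul_inv_cancel₀ hpsq]
    · rw [if_neg hpd, if_neg hpd, one_mul]
      by_cases hpm : p ∣ m
      · rw [if_pos hpm, Nat.gcd_eq_right hpm]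
        field_simp
        ring
      · rw [if_neg hpm,
          (Nat.coprime_comm.mp ((Nat.Prime.coprime_iff_not_dvd hpp).mpr hpm)).gcd_eq_one, mul_one]
        push_cast
        ring
  -- the second and third factors are eventually constant
  have h2 : Tendsto (fun n : ℕ =>
      (∏ p ∈ (Nat.primesBelow n).filter (· ∣ d), (1 - ((p : ℝ) ^ 2)⁻¹)⁻¹) *
        ∏ p ∈ (Nat.primesBelow n).filter (· ∣ m), (1 + (p : ℝ)⁻¹)⁻¹) atTop
      (𝓝 (zetaTwoCorrection d * ∏ p ∈ m.primeFactors, (1 + (p : ℝ)⁻¹)⁻¹)) := by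
    refine tendsto_const_nhds.congr' ?_
    rw [Filter.EventuallyEq, Filter.eventually_atTop]
    refine ⟨m + d + 1, fun n hn => ?_⟩
    rw [filter_dvd_primesBelow_eq hd (by omega), filter_dvd_primesBelow_eq hm (by omega),
      zetaTwoCorrection_def]
  have h3 := tendsto_prod_primesBelow_one_sub_inv_sq.mul h2
  simp_rw [← hloc] at h3
  rw [mul_assoc]
  exact tendsto_nhds_unique hE h3

/-- **The tail of the restricted singular series**: for `m, Δ ≥ 1`,
`|∑_{g > Δ, (g,d)=1} μ(g)(m,g)/g²| ≤ 4τ(m)/Δ` (majorised by the tail of `∑ (m,g)/g²`,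
`sum_Ioc_gcd_div_sq_le`). [cite: HeathBrownActa2001, §5 (5.5)] -/
theorem abs_tsum_coprimeTerm_tail_le {m Δ : ℕ} (hm : 0 < m) (hΔ : 0 < Δ) (d : ℕ) :
    |∑' i : ℕ, (if Nat.Coprime (i + (Δ + 1)) d then
        (ArithmeticFunction.moebius (i + (Δ + 1)) : ℝ) * Nat.gcd m (i + (Δ + 1)) /
          ((i + (Δ + 1) : ℕ) : ℝ) ^ 2 else 0)| ≤ 4 * (σ 0 m : ℝ) / Δ := by
  set f : ℕ → ℝ := fun g => if Nat.Coprime g d then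
    (ArithmeticFunction.moebius g : ℝ) * Nat.gcd m g / (g : ℝ) ^ 2 else 0 with hf
  have hsum0 : Summable fun g => ‖f g‖ := summable_norm_coprimeTerm hm d
  have hsum : Summable fun i => ‖f (i + (Δ + 1))‖ :=
    (summable_nat_add_iff (f := fun g => ‖f g‖) (Δ + 1)).mpr hsum0
  change |∑' i : ℕ, f (i + (Δ + 1))| ≤ _
  rw [← Real.norm_eq_abs]
  refine (norm_tsum_le_tsum_norm hsum).trans ?_
  refine Real.tsum_le_of_sum_range_le (fun _ => norm_nonneg _) fun n => ?_
  calc ∑ i ∈ range n, ‖f (i + (Δ + 1))‖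
      ≤ ∑ i ∈ range n, (Nat.gcd m (i + (Δ + 1)) : ℝ) / ((i + (Δ + 1) : ℕ) : ℝ) ^ 2 :=
        sum_le_sum fun i _ => norm_coprimeTerm_le_gcd_div_sq m d _
    _ = ∑ g ∈ Ico (Δ + 1) (Δ + 1 + n), (Nat.gcd m g : ℝ) / (g : ℝ) ^ 2 := by
        rw [sum_Ico_eq_sum_range, Nat.add_sub_cancel_left]
        refine sum_congr rfl fun i _ => ?_
        rw [add_comm]
    _ ≤ ∑ g ∈ Ioc Δ (Δ + n), (Nat.gcd m g : ℝ) / (g : ℝ) ^ 2 := by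
        refine sum_le_sum_of_subset_of_nonneg (fun g hg => ?_) fun g _ _ => by positivity
        rw [mem_Ico] at hg
        rw [mem_Ioc]
        omega
    _ ≤ 4 * (σ 0 m : ℝ) / Δ := sum_Ioc_gcd_div_sq_le hm hΔ _

/-- **Splitting the restricted singular series at `Δ`**: for `m ≥ 1`,
`∑_{g ≥ 1} f(g) = ∑_{1 ≤ g ≤ Δ} f(g) + ∑_{g > Δ} f(g)` (`f(0) = 0`).
[cite: HeathBrownActa2001, §5 (5.4)–(5.5)] -/
theorem tsum_coprimeTerm_eq_sum_add_tail {m : ℕ} (hm : 0 < m) (d Δ : ℕ) :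
    ∑' g : ℕ, (if Nat.Coprime g d then
        (ArithmeticFunction.moebius g : ℝ) * Nat.gcd m g / (g : ℝ) ^ 2 else 0) =
      ∑ g ∈ Icc 1 Δ, (if Nat.Coprime g d then
          (ArithmeticFunction.moebius g : ℝ) * Nat.gcd m g / (g : ℝ) ^ 2 else 0) +
        ∑' i : ℕ, (if Nat.Coprime (i + (Δ + 1)) d then
          (ArithmeticFunction.moebius (i + (Δ + 1)) : ℝ) * Nat.gcd m (i + (Δ + 1)) /
            ((i + (Δ + 1) : ℕ) : ℝ) ^ 2 else 0) := by
  set f : ℕ → ℝ := fun g => if Nat.Coprime g d then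
    (ArithmeticFunction.moebius g : ℝ) * Nat.gcd m g / (g : ℝ) ^ 2 else 0 with hf
  have hsum : Summable f := (summable_norm_coprimeTerm hm d).of_norm
  have h := hsum.sum_add_tsum_nat_add (Δ + 1)
  have hf₀ : f 0 = 0 := by
    simp only [hf]
    split_ifs <;> simp
  change ∑' g, f g = ∑ g ∈ Icc 1 Δ, f g + ∑' i, f (i + (Δ + 1))
  rw [← h, Finset.range_eq_Ico, ← Finset.insert_Ico_add_one_left_eq_Ico (Nat.succ_pos Δ),
    sum_insert (by simp), hf₀, zero_add]
  rfl

/-! ### The class main term as a singular series -/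

/-- **The class Type-I main term as a singular series** (class analogue of (5.4), p. 31): for
`R ∈ 𝒯r` and `d ≥ 1` with `(d, N(R)) = 1`,
`(6/π²)·(ζ(2)/ζ_d(2))·ρ₂(R)/N(R) = N(R)⁻¹ ∑_{g ≥ 1, (g,d)=1} μ(g)(N(R),g)/g²`
(`tsum_moebius_gcd_div_sq_coprime` with `ρ₂(R) = ∏_{p∣N(R)}(1 + 1/p)⁻¹`, `rho₂_eq_of_squarefree`).
[cite: HeathBrownMoroz2004, Lemma 2.4 (2.29)] [cite: HeathBrownActa2001, §5 (5.4)] -/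
theorem classMainTerm_eq_tsum {R : Ideal (𝓞 K)} (hR : Squarefree (Ideal.absNorm R)) {d : ℕ}
    (hd : 0 < d) (hdR : Nat.Coprime d (Ideal.absNorm R)) :
    6 / Real.pi ^ 2 * zetaTwoCorrection d * rho₂ R / Ideal.absNorm R =
      (Ideal.absNorm R : ℝ)⁻¹ *
        ∑' g : ℕ, (if Nat.Coprime g d then
          (ArithmeticFunction.moebius g : ℝ) * Nat.gcd (Ideal.absNorm R) g / (g : ℝ) ^ 2
          else 0) := by
  rw [tsum_moebius_gcd_div_sq_coprime (Nat.pos_of_ne_zero hR.ne_zero) hd hdR.symm,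
    rho₂_eq_of_squarefree hR]
  ring

/-! ### The class error of one `R ∈ 𝒯r`, split at `Δ` -/

open scoped Classical in
/-- **Splitting the class error at `Δ`** (class analogue of p. 31 of the 2001 paper / of
`abs_countA_sub_mainTerm_le`), uniformly in `R ∈ 𝒯r` and in the admissible class: for `X ≥ 0`,
`1 ≤ Δ ≤ D` and `D ≥ ⌊X(1+η)⌋`,
`|#𝒜_R(class) − [(d,N(R))=1](6η²X²/π²)(ζ(2)/ζ_d(2))d⁻²ρ₂(R)/N(R)|
   ≤ ∑_{g ≤ Δ} |S_g(R) − [(g,d)=1][(d,N(R))=1] η²X²N((R,g))/(g²d²N(R))| + ∑_{Δ<g≤D} S_g(R)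
     + (η²X²/(d²N(R)))·4τ(N(R))/Δ`,
where `S_g(R) = #{x', y' ∈ (X/g, X(1+η)/g] : gx' ≡ a, gy' ≡ b (mod d), R ∣ (g)(x' + y'·2^{1/3})}`:
for `(d, N(R)) = 1` by the class (5.3) (`classCountA_eq_sum_moebius`), the class (5.4)
(`classMainTerm_eq_tsum`, `(N(R), g) = N((R,g))` by `absNorm_sup_span_natCast`) and the tail bound
`abs_tsum_coprimeTerm_tail_le`; for `(d, N(R)) ≠ 1` the class count vanishes
(`classCountA_eq_zero_of_not_coprime`) and the right-hand side is nonnegative.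
[cite: HeathBrownMoroz2004, Lemma 2.3] [cite: HeathBrownActa2001, §5 pp. 31–32] -/
theorem abs_classCountA_sub_mainTerm_le {X η : ℝ} (hX : 0 ≤ X) {R : Ideal (𝓞 K)}
    (hR : Squarefree (Ideal.absNorm R)) {d a b : ℕ} (hd : 0 < d)
    (hadm : Nat.Coprime (a ^ 3 + 2 * b ^ 3) d) {Δ D : ℕ} (hΔ : 0 < Δ) (hΔD : Δ ≤ D)
    (hD : ⌊X * (1 + η)⌋₊ ≤ D) :
    |(classCountA X η d a b R : ℝ) -
        (if Nat.Coprime d (Ideal.absNorm R) then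
          6 * η ^ 2 * X ^ 2 / Real.pi ^ 2 * zetaTwoCorrection d / (d : ℝ) ^ 2 * rho₂ R /
            Ideal.absNorm R else 0)| ≤
      ∑ g ∈ Icc 1 Δ,
          |(#{xy ∈ latticeBox (X / g) η | g * xy.1 ≡ a [MOD d] ∧ g * xy.2 ≡ b [MOD d] ∧
              R ∣ Ideal.span {(g : 𝓞 K)} * pairIdeal xy} : ℝ) -
            (if Nat.Coprime g d ∧ Nat.Coprime d (Ideal.absNorm R) then
              η ^ 2 * X ^ 2 * Ideal.absNorm (R ⊔ Ideal.span {(g : 𝓞 K)}) /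
                ((g : ℝ) ^ 2 * (d : ℝ) ^ 2 * Ideal.absNorm R) else 0)| +
        ∑ g ∈ Ioc Δ D,
          (#{xy ∈ latticeBox (X / g) η | g * xy.1 ≡ a [MOD d] ∧ g * xy.2 ≡ b [MOD d] ∧
              R ∣ Ideal.span {(g : 𝓞 K)} * pairIdeal xy} : ℝ) +
        η ^ 2 * X ^ 2 / ((d : ℝ) ^ 2 * Ideal.absNorm R) * (4 * σ 0 (Ideal.absNorm R) / Δ) := by
  by_cases hdR : Nat.Coprime d (Ideal.absNorm R)
  swap
  · rw [if_neg hdR, classCountA_eq_zero_of_not_coprime hadm fun h => hdR h.symm, Nat.cast_zero,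
      sub_zero, abs_zero]
    positivity
  rw [if_pos hdR]
  set m := Ideal.absNorm R with hmdef
  have hm : 0 < m := Nat.pos_of_ne_zero hR.ne_zero
  have hm' : (0 : ℝ) < m := by exact_mod_cast hm
  have hd' : (0 : ℝ) < d := by exact_mod_cast hd
  set L : ℕ → ℝ := fun g =>
    (#{xy ∈ latticeBox (X / g) η | g * xy.1 ≡ a [MOD d] ∧ g * xy.2 ≡ b [MOD d] ∧
      R ∣ Ideal.span {(g : 𝓞 K)} * pairIdeal xy} : ℝ) with hL
  set M : ℕ → ℝ := fun g => if Nat.Coprime g d ∧ Nat.Coprime d m then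
    η ^ 2 * X ^ 2 * Ideal.absNorm (R ⊔ Ideal.span {(g : 𝓞 K)}) / ((g : ℝ) ^ 2 * (d : ℝ) ^ 2 * m)
    else 0 with hM
  set f : ℕ → ℝ := fun g => if Nat.Coprime g d then
    (ArithmeticFunction.moebius g : ℝ) * Nat.gcd m g / (g : ℝ) ^ 2 else 0 with hf
  set Tail : ℝ := ∑' i : ℕ, f (i + (Δ + 1)) with hTail
  -- the class (5.3)
  have h53 : (classCountA X η d a b R : ℝ) =
      ∑ g ∈ Icc 1 D, (ArithmeticFunction.moebius g : ℝ) * L g := by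
    have h := congr_arg (Int.cast : ℤ → ℝ) (classCountA_eq_sum_moebius hX d a b R hD)
    push_cast at h
    exact h
  -- the class (5.4)
  have h54 : 6 * η ^ 2 * X ^ 2 / Real.pi ^ 2 * zetaTwoCorrection d / (d : ℝ) ^ 2 * rho₂ R / m =
      ∑ g ∈ Icc 1 Δ, (ArithmeticFunction.moebius g : ℝ) * M g +
        η ^ 2 * X ^ 2 / ((d : ℝ) ^ 2 * m) * Tail := by
    have hmt := classMainTerm_eq_tsum hR hd hdR
    rw [← hmdef, tsum_coprimeTerm_eq_sum_add_tail hm d Δ] at hmt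
    have hMg : ∀ g ∈ Icc 1 Δ, (ArithmeticFunction.moebius g : ℝ) * M g =
        η ^ 2 * X ^ 2 / ((d : ℝ) ^ 2 * m) * f g := by
      intro g hg
      have hg0 : (0 : ℝ) < g := by exact_mod_cast (mem_Icc.mp hg).1
      simp only [hM, hf]
      split_ifs with h1 h2 h2
      · rw [absNorm_sup_span_natCast hR g, ← hmdef]
        field_simp
      · exact absurd h1.1 h2
      · exact absurd ⟨h2, hdR⟩ h1
      · rw [mul_zero, mul_zero]
    rw [sum_congr rfl hMg, ← mul_sum, ← mul_add]
    calc 6 * η ^ 2 * X ^ 2 / Real.pi ^ 2 * zetaTwoCorrection d / (d : ℝ) ^ 2 * rho₂ R / m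
        = η ^ 2 * X ^ 2 / (d : ℝ) ^ 2 * (6 / Real.pi ^ 2 * zetaTwoCorrection d * rho₂ R / m) := by
          ring
      _ = η ^ 2 * X ^ 2 / (d : ℝ) ^ 2 * ((m : ℝ)⁻¹ * (∑ g ∈ Icc 1 Δ, f g + Tail)) := by rw [hmt]
      _ = η ^ 2 * X ^ 2 / ((d : ℝ) ^ 2 * m) * (∑ g ∈ Icc 1 Δ, f g + Tail) := by
          field_simp
  -- split the Möbius sum at `Δ`
  have hsplit : ∑ g ∈ Icc 1 D, (ArithmeticFunction.moebius g : ℝ) * L g =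
      ∑ g ∈ Icc 1 Δ, (ArithmeticFunction.moebius g : ℝ) * L g +
        ∑ g ∈ Ioc Δ D, (ArithmeticFunction.moebius g : ℝ) * L g := by
    rw [← Finset.Ico_add_one_right_eq_Icc 1 D, ← Finset.Ico_add_one_right_eq_Icc 1 Δ,
      ← Finset.Ico_add_one_add_one_eq_Ioc Δ D]
    exact (sum_Ico_consecutive _ (by omega) (by omega)).symm
  -- the identity
  have hid : (classCountA X η d a b R : ℝ) -
      6 * η ^ 2 * X ^ 2 / Real.pi ^ 2 * zetaTwoCorrection d / (d : ℝ) ^ 2 * rho₂ R / m =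
      ∑ g ∈ Icc 1 Δ, (ArithmeticFunction.moebius g : ℝ) * (L g - M g) +
        ∑ g ∈ Ioc Δ D, (ArithmeticFunction.moebius g : ℝ) * L g -
          η ^ 2 * X ^ 2 / ((d : ℝ) ^ 2 * m) * Tail := by
    rw [h53, h54, hsplit]
    simp only [mul_sub, sum_sub_distrib]
    ring
  -- the three bounds (`|μ(g)| ≤ 1`)
  have hμ : ∀ (g : ℕ) (x : ℝ), |(ArithmeticFunction.moebius g : ℝ) * x| ≤ |x| := fun g x => by
    have h : |(ArithmeticFunction.moebius g : ℝ)| ≤ 1 := by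
      exact_mod_cast ArithmeticFunction.abs_moebius_le_one
    rw [abs_mul]
    calc |(ArithmeticFunction.moebius g : ℝ)| * |x| ≤ 1 * |x| :=
        mul_le_mul_of_nonneg_right h (abs_nonneg _)
      _ = |x| := one_mul _
  have hLnn : ∀ g, 0 ≤ L g := fun g => by simp only [hL]; positivity
  have h1 : |∑ g ∈ Icc 1 Δ, (ArithmeticFunction.moebius g : ℝ) * (L g - M g)| ≤
      ∑ g ∈ Icc 1 Δ, |L g - M g| :=
    (abs_sum_le_sum_abs _ _).trans (sum_le_sum fun g _ => hμ g _)
  have h2 : |∑ g ∈ Ioc Δ D, (ArithmeticFunction.moebius g : ℝ) * L g| ≤ ∑ g ∈ Ioc Δ D, L g :=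
    (abs_sum_le_sum_abs _ _).trans (sum_le_sum fun g _ => (hμ g _).trans_eq (abs_of_nonneg (hLnn g)))
  have h3 : |η ^ 2 * X ^ 2 / ((d : ℝ) ^ 2 * m) * Tail| ≤
      η ^ 2 * X ^ 2 / ((d : ℝ) ^ 2 * m) * (4 * σ 0 m / Δ) := by
    rw [abs_mul, abs_of_nonneg (by positivity : (0 : ℝ) ≤ η ^ 2 * X ^ 2 / ((d : ℝ) ^ 2 * m))]
    exact mul_le_mul_of_nonneg_left (abs_tsum_coprimeTerm_tail_le hm hΔ d) (by positivity)
  rw [hid]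
  calc |∑ g ∈ Icc 1 Δ, (ArithmeticFunction.moebius g : ℝ) * (L g - M g) +
          ∑ g ∈ Ioc Δ D, (ArithmeticFunction.moebius g : ℝ) * L g -
            η ^ 2 * X ^ 2 / ((d : ℝ) ^ 2 * m) * Tail|
      ≤ |∑ g ∈ Icc 1 Δ, (ArithmeticFunction.moebius g : ℝ) * (L g - M g)| +
          |∑ g ∈ Ioc Δ D, (ArithmeticFunction.moebius g : ℝ) * L g| +
            |η ^ 2 * X ^ 2 / ((d : ℝ) ^ 2 * m) * Tail| := by
        refine (abs_sub _ _).trans ?_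
        linarith [abs_add_le (∑ g ∈ Icc 1 Δ, (ArithmeticFunction.moebius g : ℝ) * (L g - M g))
          (∑ g ∈ Ioc Δ D, (ArithmeticFunction.moebius g : ℝ) * L g)]
    _ ≤ _ := add_le_add (add_le_add h1 h2) h3

end Literature.NumberTheory.Sieve.CubicSieve

end
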